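import Summits.QuantumFields.YangMills.Theorems.BalabanUVNodesSpineReadingOfRecord13CoPH
import Literature.MathematicalPhysics.QuantumFieldTheory.Balaban1983to89.Node00.StepWeightsAtThresholds

/-!
# N21 (NE7c) · THE SHELL SPLIT OF RECORD — definition lane: the TOP-LEVEL threshold-shell part of a (2.18) term of record, its per-cube pieces,
# the cube-truncated class weights, and the keyed shell split `shellSplitOfRecord₁₃At K₀ ρA ρB : ShellSplit₁₃CoPH N K₀` INHABITING the one residual
# reading of dag-n20-d's spine reading of record `YMDAG.UVSplit.crOfRecord₁₃At K₀ jcut sh` (p587226, R5: «`sh` … NOT OF RECORD … the one residual reading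
# to INHABIT, not hidden»)

R134 seat `pub-ymgap-dag-n21-d` (g9), node N21 = NE7c (single-run shell-weight bound; NOT PRINTED in [Bałaban 1983–89], NOT proved), strategy s2 = the
by-name knit AT THE RECORD; lane K3⁷ `SpineGivenEndpointR13SepCoPH` (stmt-QuantumFields-20544, `--supports … --as helper`; COUNT-NEUTRAL).  DEFINITION LANE:
ten `def`s ∕ `abbrev` + their `rfl` ∕ unfolding faces; NO estimate.  Companion (theorems): `…N21ShellSplitOfRecord13CoPH` — the (R)-fields `0 ≤ σ ≤ weight`,
the per-cube COVER and the COUNT of top cubes PROVED at the record, the per-cube (M1) DISPLAYED, ⇒ `T4IndicatorShell.ShellWeightBound` at `crOfRecord₁₃At`.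
[III] = [Balaban1988Convergent], [LF-I] = [Balaban1989LargeFieldI].

THE READING (why the top level).  In NODE 00's (2.18) term of record the class weight of one sequence `s` at source `t` is
`classWeightOfDatum₉ … k t s = ∫ χ_k(Ω_k(s))(V)·slot_s(V) dV_k` (`Node00/DressedSlotsOfRecord12`) with def-R's front factor `chiSeqOfRecord` = [III] (2.17)
`Π_{□⊂Ω_k} χ({sup_{p⊂□^∼}|U_{k,□}(V_k,∂p) − 1| < ε_kη²})` AT THE TOP LEVEL `k` ONLY: the characteristic functions of older levels sit INTEGRATED inside the dressed
slot `dressedSlotsOfDatum₉` (fluctuation integrals), so the only SHARP `V_k`-indicator slots a term of record carries are its top-level `LM₂R_k`-cubes `□ ⊂ Ω_k(s)`.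
Design (i) of `T4IndicatorShell` («some tested variable within `Δ` of its threshold») therefore reads, for run A at comparison `K` (`k = K₀ + K`): the term's SHELL PART
is the part of its weight where `χ_k` at the threshold `ε_k` of record PASSES but `χ_k` at the LOWERED threshold `ε_k(1 − ρ)` FAILS — [LF-I] p. 193's mechanism
(«for any extension we have |∂U_{k,Z} − 1| ≥ 2ε_kη² … Thus 1 − χ_{k,Λ} is a large field function») AS THE TERM's OWN SHELL PART, typed with def-T's threshold-letter
version `chiSeqOfRecordAt` (`Node00/StepWeightsAtThresholds`, `chiSeqOfRecord_eq_at` is `rfl`).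

WHAT IS DEFINED (objects; every face `rfl` or a one-line unfolding).
* §1 `cubeChiAt F N ν g Kc k δ a` — ONE cube's (2.17) slot indicator of record at a threshold LETTER `δ` (the factor of `chiSeqOfRecordAt` at cube `a`);
  `cubesOfSeq … s` — the top cubes inside `Ω_k(s)`; face `chiSeqOfRecordAt_eq_prod_cubeChiAt` (`chi218_apply`).
* §2 at NODE 00's generality (`ϑ : Stage9Params`, any datum `D`, run `p`, history `g`, level `k` — the letters of `classWeightOfDatum₉`):
  `shellWeightOfDatum₉ … ρ t s := ∫ χ_k^{ε_k}(s)·(1 − χ_k^{ε_k(1−ρ)}(s))·slot_s` (THE TERM's SHELL PART at relative width `ρ`);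
  `shellPieceOfDatum₉ … ρ t a s := 𝟙[a ⊂ Ω_k(s)]·∫ (1 − χ_a^{ε_k(1−ρ)})·χ_k^{ε_k}(s)·slot_s` (its PIECE at top cube `a`);
  `cubeWeightOfDatum₉ … t a s := 𝟙[a ⊂ Ω_k(s)]·classWeightOfDatum₉ … t s` (the `a`-TRUNCATED class weight — the mass of the law on which (M1) is asked);
  `cubeLawOfDatum₉ … t a` — that law as a `Measure` on the level-`k` fields (`Σ_{s : a ⊂ Ω_k(s)} (χ_k^{ε_k}(s)·slot^t_s)·dV_k`), the carrier of `T4ShellMeasure.SlotAntiConcentration`.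
* §4 (v1.1, append-only) `cubeDensityOfDatum₉` (the summed `ENNReal` density of the truncated law) · `blockFibreLawOfDatum₉ … t a b x` (its BLOCK FIBRE LAW at an
  exterior field `x` along a finite bond set `b`: product Haar on `↥b → SU(N)` with the density read through `Function.updateFinset x b`) · `blockReading u b x`
  (a statistic read on the block fibre) · `cubeStat` (THE CUBE STATISTIC OF RECORD `sup_{p⊂a^∼}|U_{k,a}(V)(∂p) − 1|∕η_k²`) · `inputBlock` (THE INPUT BLOCK OF RECORD
  `liftIter k (inputs 𝐁_k(a^{∼4}))` as a `Finset`).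
* §5 (v1.2, append-only) `termFibreLawOfDatum₉ … t s b x` (the block fibre law of ONE term: product Haar on `(SU N)^b` with density «χ_k(Ω_k(s))·slot_s, exterior
  frozen» — the consumable product shape; summed over the terms testing `a` it is the block fibre law of the truncated law).
* §3 at the `CoPH`-keyed Stage-13 record (n20-d's letters `runA₁₃ ∕ runB₁₃ ∕ histA₁₃ ∕ histB₁₃ ∕ keyA₁₃ ∕ keyB₁₃`): the keyed fibre sums `shellA₁₃ ∕ shellB₁₃` of the two
  runs' term shell parts (run A at level `K₀ + K`, run B at `K₀ + K + 1`), the width letters `WidthLetter₁₃CoPH`, and ★ `shellSplitOfRecord₁₃At K₀ ρA ρB :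
  ShellSplit₁₃CoPH N K₀` with its `rfl` dictionary against `crOfRecord₁₃At K₀ jcut (shellSplitOfRecord₁₃At K₀ ρA ρB)` (`…_shA ∕ _shB`).

HONEST FRAMING.  Definitions + `rfl` faces; NO estimate; the relative widths `ρA ∕ ρB` are LETTERS (N16's closeness ∕ the consumer's); (M1) per top cube is NOT
PRINTED and NOT proved (it is the companion's displayed hypothesis); nothing of Bałaban's asserted; no `Provisos₁₃CoPH` inhabitant claimed (K0⁷ open); NE7c NOT
proved; N21 NOT discharged; K3⁷ NOT claimed; counts UNMOVED (typed 28∕28 · discharged 5∕27).  No `sorry`, no `axiom`, no `instance`, no `notation`.  One finite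
four-torus programme at fixed `ε` — NOT ℝ⁴, NOT OS, NOT a mass gap, NOT the Clay problem.
-/

noncomputable section

open scoped BigOperators
open Finset MeasureTheory

namespace Summit.QuantumFields.YangMills.Theorems.N21ShellSplitOfRecord13CoPH

open Literature.MathematicalPhysics.QuantumFieldTheory.Balaban1983to89
open Literature.MathematicalPhysics.QuantumFieldTheory.Balaban1983to89.T4Continuum
open Literature.MathematicalPhysics.QuantumFieldTheory.Balaban1983to89.Node00
open B14.Eq218Concrete (cubesIn chi218_apply)
open YMDAG.UVSplit (crOfRecord₁₃At ShellSplit₁₃CoPH keyA₁₃ keyB₁₃ runA₁₃ runB₁₃ histA₁₃ histB₁₃ classSet₁₃ weightA₁₃ weightB₁₃)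

/-! ## §1 One cube's slot indicator of record at a threshold letter; the cubes of a sequence -/

section Cube

variable (F : T4Family) (N : ℕ) [NeZero N] (ν : Stage7Numerics) (M : ℕ) (g : ℕ → ℝ) (Kc k : ℕ)

/-- **ONE CUBE's (2.17) SLOT INDICATOR OF RECORD AT A THRESHOLD LETTER `δ`**: for the top cube `a` of the record's `LM₂R_k`-partition,
`χ({sup_{p⊂a^∼}|U_{k,a}(V_k,∂p) − 1| < δ·η_k²})` with the (2.16) local background of record on `a^{∼4}` — the factor of def-T's `chiSeqOfRecordAt` at `a`
(values in `{0,1}`). [bookkeeping] -/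
def cubeChiAt (δ : ℝ) (a : ↥(cubeIndices (F.P Kc) (cubeSide (F.P Kc).L ν.M₂ (RkOfRecord (F.P Kc).L ν.r (g k)) k)))
    (V : GaugeField (F.P Kc) k (SU N)) : ℝ :=
  chiSmall (plaqInside (cubeEnl (F.P Kc) (cubeSide (F.P Kc).L ν.M₂ (RkOfRecord (F.P Kc).L ν.r (g k)) k) a 1)) (δ * (F.P Kc).eta k ^ 2)
    (B14.Eq216Concrete.ukBox (bgOfRecord (avOfRecord F N Kc) {U | PlaqSmall (ν.εreg * (F.P Kc).eta k ^ 2) U}) ν.M₁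
      (cubeEnl (F.P Kc) (cubeSide (F.P Kc).L ν.M₂ (RkOfRecord (F.P Kc).L ν.r (g k)) k) a 4) k V)

variable {N} in
/-- **THE TOP CUBES INSIDE `Ω_k(s)`** (the product range of (2.17) for the sequence `s`). [bookkeeping] -/
def cubesOfSeq (s : SeqOfRecord F ν M g Kc k) :
    Finset ↥(cubeIndices (F.P Kc) (cubeSide (F.P Kc).L ν.M₂ (RkOfRecord (F.P Kc).L ν.r (g k)) k)) :=
  cubesIn (fun a => cubeEnl (F.P Kc) (cubeSide (F.P Kc).L ν.M₂ (RkOfRecord (F.P Kc).L ν.r (g k)) k) a 0) (s.Ω k)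

/-- **FACE**: def-T's front factor at the letter `δ` IS the product of the cube indicators over the cubes of the sequence (`chi218_apply`). [bookkeeping] -/
theorem chiSeqOfRecordAt_eq_prod_cubeChiAt (δ : ℝ) (s : SeqOfRecord F ν M g Kc k) (V : GaugeField (F.P Kc) k (SU N)) :
    chiSeqOfRecordAt F N ν M g Kc k δ s V = ∏ a ∈ cubesOfSeq F ν M g Kc k s, cubeChiAt F N ν g Kc k δ a V := by
  rw [chiSeqOfRecordAt, chi218_apply]
  rfl

/-- The cube indicator takes the values `0` and `1` only. [bookkeeping] -/
theorem cubeChiAt_eq_zero_or_one (δ : ℝ) (a : ↥(cubeIndices (F.P Kc) (cubeSide (F.P Kc).L ν.M₂ (RkOfRecord (F.P Kc).L ν.r (g k)) k)))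
    (V : GaugeField (F.P Kc) k (SU N)) : cubeChiAt F N ν g Kc k δ a V = 0 ∨ cubeChiAt F N ν g Kc k δ a V = 1 := by
  unfold cubeChiAt chiSmall
  split_ifs <;> simp

end Cube

/-! ## §2 The term's shell part, its per-cube pieces and the cube-truncated class weight (NODE 00's generality) -/

section Term

variable (F : T4Family) (N : ℕ) [NeZero N] (ϑ : Stage9Params F N) (D : FiniteEpsData F (SU N)) (g₀ : ℕ → ℝ) (os : List (ULoop F))
  (p : B12.RunParams) (g : ℕ → ℝ) (k : ℕ)

/-- ★ **THE TERM's SHELL PART at relative width `ρ`** (run at cutoff `p.K`, level `k`, source `t`, sequence `s`):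
`∫ χ_k^{ε_k}(Ω_k(s))(V)·(1 − χ_k^{ε_k(1−ρ)}(Ω_k(s))(V))·slot^{t}_k(s)(V) dV_k` — the part of the class weight `classWeightOfDatum₉ … k t s` carried by fields for
which every top cube of `s` passes the (2.17) test at the threshold `ε_k` of record while SOME top cube fails it at the LOWERED threshold `ε_k(1 − ρ)` ([LF-I] p. 193's
mechanism as the term's own shell part; design (i) of `T4IndicatorShell`). [bookkeeping] -/
def shellWeightOfDatum₉ (ρ t : ℝ) (s : SeqOfRecord F ϑ.ν ϑ.τ9.M g p.K k) : ℝ :=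
  ∫ V, chiSeqOfRecord F N ϑ.ν ϑ.τ9.M g p.K k s V *
      (1 - chiSeqOfRecordAt F N ϑ.ν ϑ.τ9.M g p.K k (epsOfRecord ϑ.ν g k * (1 - ρ)) s V) *
      dressedSlotsOfDatum₉ F N ϑ D g₀ os t p g k s V ∂fieldMeasure (F.P p.K) k (SU N)

/-- ★ **THE TERM's SHELL PIECE AT THE TOP CUBE `a`**: zero unless `a ⊂ Ω_k(s)`, and then `∫ (1 − χ_a^{ε_k(1−ρ)}(V))·χ_k^{ε_k}(Ω_k(s))(V)·slot^{t}_k(s)(V) dV_k` — the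
part of the class weight on which cube `a` itself fails the lowered test. [bookkeeping] -/
def shellPieceOfDatum₉ (ρ t : ℝ) (a : ↥(cubeIndices (F.P p.K) (cubeSide (F.P p.K).L ϑ.ν.M₂ (RkOfRecord (F.P p.K).L ϑ.ν.r (g k)) k)))
    (s : SeqOfRecord F ϑ.ν ϑ.τ9.M g p.K k) : ℝ :=
  if a ∈ cubesOfSeq F ϑ.ν ϑ.τ9.M g p.K k s then
    ∫ V, (1 - cubeChiAt F N ϑ.ν g p.K k (epsOfRecord ϑ.ν g k * (1 - ρ)) a V) *
        (chiSeqOfRecord F N ϑ.ν ϑ.τ9.M g p.K k s V * dressedSlotsOfDatum₉ F N ϑ D g₀ os t p g k s V) ∂fieldMeasure (F.P p.K) k (SU N)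
  else 0

/-- ★ **THE `a`-TRUNCATED CLASS WEIGHT**: the class weight of `s` if the top cube `a` lies in `Ω_k(s)`, else `0` — summed over `s`, the total mass of the run's
dressed law restricted to the terms that TEST cube `a` (with `a`'s own `ε_k`-cut included): the law on which the per-cube (M1) is asked. [bookkeeping] -/
def cubeWeightOfDatum₉ (t : ℝ) (a : ↥(cubeIndices (F.P p.K) (cubeSide (F.P p.K).L ϑ.ν.M₂ (RkOfRecord (F.P p.K).L ϑ.ν.r (g k)) k)))
    (s : SeqOfRecord F ϑ.ν ϑ.τ9.M g p.K k) : ℝ :=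
  if a ∈ cubesOfSeq F ϑ.ν ϑ.τ9.M g p.K k s then classWeightOfDatum₉ F N ϑ D g₀ os p g k t s else 0

/-- Face: off `Ω_k(s)` the piece vanishes. [bookkeeping] -/
theorem shellPieceOfDatum₉_of_not_mem {ρ t : ℝ}
    {a : ↥(cubeIndices (F.P p.K) (cubeSide (F.P p.K).L ϑ.ν.M₂ (RkOfRecord (F.P p.K).L ϑ.ν.r (g k)) k))} {s : SeqOfRecord F ϑ.ν ϑ.τ9.M g p.K k}
    (h : a ∉ cubesOfSeq F ϑ.ν ϑ.τ9.M g p.K k s) : shellPieceOfDatum₉ F N ϑ D g₀ os p g k ρ t a s = 0 := by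
  rw [shellPieceOfDatum₉, if_neg h]

/-- Face: on `Ω_k(s)` the piece is the displayed integral. [bookkeeping] -/
theorem shellPieceOfDatum₉_of_mem {ρ t : ℝ}
    {a : ↥(cubeIndices (F.P p.K) (cubeSide (F.P p.K).L ϑ.ν.M₂ (RkOfRecord (F.P p.K).L ϑ.ν.r (g k)) k))} {s : SeqOfRecord F ϑ.ν ϑ.τ9.M g p.K k}
    (h : a ∈ cubesOfSeq F ϑ.ν ϑ.τ9.M g p.K k s) :
    shellPieceOfDatum₉ F N ϑ D g₀ os p g k ρ t a s =
      ∫ V, (1 - cubeChiAt F N ϑ.ν g p.K k (epsOfRecord ϑ.ν g k * (1 - ρ)) a V) *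
        (chiSeqOfRecord F N ϑ.ν ϑ.τ9.M g p.K k s V * dressedSlotsOfDatum₉ F N ϑ D g₀ os t p g k s V) ∂fieldMeasure (F.P p.K) k (SU N) := by
  rw [shellPieceOfDatum₉, if_pos h]

/-- Face: off `Ω_k(s)` the truncated weight vanishes. [bookkeeping] -/
theorem cubeWeightOfDatum₉_of_not_mem {t : ℝ}
    {a : ↥(cubeIndices (F.P p.K) (cubeSide (F.P p.K).L ϑ.ν.M₂ (RkOfRecord (F.P p.K).L ϑ.ν.r (g k)) k))} {s : SeqOfRecord F ϑ.ν ϑ.τ9.M g p.K k}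
    (h : a ∉ cubesOfSeq F ϑ.ν ϑ.τ9.M g p.K k s) : cubeWeightOfDatum₉ F N ϑ D g₀ os p g k t a s = 0 := by
  rw [cubeWeightOfDatum₉, if_neg h]

/-- Face: on `Ω_k(s)` the truncated weight is the class weight. [bookkeeping] -/
theorem cubeWeightOfDatum₉_of_mem {t : ℝ}
    {a : ↥(cubeIndices (F.P p.K) (cubeSide (F.P p.K).L ϑ.ν.M₂ (RkOfRecord (F.P p.K).L ϑ.ν.r (g k)) k))} {s : SeqOfRecord F ϑ.ν ϑ.τ9.M g p.K k}
    (h : a ∈ cubesOfSeq F ϑ.ν ϑ.τ9.M g p.K k s) :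
    cubeWeightOfDatum₉ F N ϑ D g₀ os p g k t a s = classWeightOfDatum₉ F N ϑ D g₀ os p g k t s := by
  rw [cubeWeightOfDatum₉, if_pos h]

/-- ★ **THE `a`-TRUNCATED DRESSED LAW OF RECORD** (a positive measure on the level-`k` fields at source `t`): `Σ_{s : a ⊂ Ω_k(s)} χ_k^{ε_k}(Ω_k(s))·slot^t_k(s) · dV_k` —
the run's dressed (2.18) law restricted to the terms that TEST the top cube `a`, `a`'s own `ε_k`-cut included.  Its total mass is `Σ_s cubeWeightOfDatum₉ … t a s`, its mass
on «`a` fails the lowered test» is `Σ_s shellPieceOfDatum₉ … ρ t a s` (companion `…Law`); the per-top-cube (M1) is `T4ShellMeasure.SlotAntiConcentration` ON THIS MEASURE.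
[bookkeeping] -/
def cubeLawOfDatum₉ (t : ℝ) (a : ↥(cubeIndices (F.P p.K) (cubeSide (F.P p.K).L ϑ.ν.M₂ (RkOfRecord (F.P p.K).L ϑ.ν.r (g k)) k))) :
    Measure (GaugeField (F.P p.K) k (SU N)) :=
  ∑ s : SeqOfRecord F ϑ.ν ϑ.τ9.M g p.K k,
    if a ∈ cubesOfSeq F ϑ.ν ϑ.τ9.M g p.K k s then
      (fieldMeasure (F.P p.K) k (SU N)).withDensity
        (fun V => ENNReal.ofReal (chiSeqOfRecord F N ϑ.ν ϑ.τ9.M g p.K k s V * dressedSlotsOfDatum₉ F N ϑ D g₀ os t p g k s V))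
    else 0

end Term

/-! ## §3 The keyed shell split at the `CoPH`-keyed Stage-13 record -/

section Keyed

variable {F : T4Family} {N : ℕ} [NeZero N]

/-- **RUN A's KEYED SHELL PART OF RECORD** (comparison `K`, level `K₀ + K`, relative widths `ρ K`): the fibre sum, along n20-d's key of record `keyA₁₃`, of the
term shell parts of the tuple's own dressed family at its own datum. [bookkeeping] -/
def shellA₁₃ (θ : Stage13HParams F N) (hP : θ.Provisos₁₃CoPH F N) (K₀ : ℕ) (g₀ : ℕ → ℝ) (os : List (ULoop F)) (ρ : ℕ → ℝ)
    (K : ℕ) (t : ℝ) (x : Σ K, SiteSeqKey F (K₀ + K)) : ℝ :=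
  letI : ∀ Kc, DecidableEq (SiteSeqKey F Kc) := fun _ => Classical.decEq _
  ∑ s ∈ univ.filter (fun s => keyA₁₃ θ K₀ g₀ K s = x),
    shellWeightOfDatum₉ F N θ.toStage9Params (datumOfRecord₁₃CoPH F N θ hP) g₀ os (runA₁₃ F K₀ g₀ K) (histA₁₃ θ K₀ g₀ K) (K₀ + K) (ρ K) t s

/-- **RUN B's KEYED SHELL PART OF RECORD** (comparison `K`, level `K₀ + K + 1`, along `keyB₁₃`). [bookkeeping] -/
def shellB₁₃ (θ : Stage13HParams F N) (hP : θ.Provisos₁₃CoPH F N) (K₀ : ℕ) (g₀ : ℕ → ℝ) (os : List (ULoop F)) (ρ : ℕ → ℝ)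
    (K : ℕ) (t : ℝ) (x : Σ K, SiteSeqKey F (K₀ + K)) : ℝ :=
  letI : ∀ Kc, DecidableEq (SiteSeqKey F Kc) := fun _ => Classical.decEq _
  ∑ s' ∈ univ.filter (fun s' => keyB₁₃ θ K₀ g₀ K s' = x),
    shellWeightOfDatum₉ F N θ.toStage9Params (datumOfRecord₁₃CoPH F N θ hP) g₀ os (runB₁₃ F K₀ g₀ K) (histB₁₃ θ K₀ g₀ K) (K₀ + K + 1) (ρ K) t s'

variable (N) in
/-- **WIDTH LETTERS**: a relative shell width per tuple and comparison index (N16's two-run closeness ∕ the consumer's choice; a LETTER here). [bookkeeping] -/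
abbrev WidthLetter₁₃CoPH : Type 1 :=
  (F : T4Family) → (θ : Stage13HParams F N) → θ.Provisos₁₃CoPH F N → (ℕ → ℝ) → List (ULoop F) → ℕ → ℝ

variable (N) in
/-- ★ **THE SHELL SPLIT OF RECORD AT OFFSET `K₀`** with width letters `ρA ∕ ρB`: the pair `(shellA₁₃, shellB₁₃)` at every tuple — an INHABITANT of n20-d's
`ShellSplit₁₃CoPH N K₀`, the one residual reading of `crOfRecord₁₃At`. [bookkeeping] -/
def shellSplitOfRecord₁₃At (K₀ : ℕ) (ρA ρB : WidthLetter₁₃CoPH N) : ShellSplit₁₃CoPH N K₀ := fun F θ hP g₀ os =>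
  (shellA₁₃ θ hP K₀ g₀ os (ρA F θ hP g₀ os), shellB₁₃ θ hP K₀ g₀ os (ρB F θ hP g₀ os))

/-- Dictionary: the split's first component is `shellA₁₃`. [bookkeeping] -/
@[simp] theorem shellSplitOfRecord₁₃At_fst (K₀ : ℕ) (ρA ρB : WidthLetter₁₃CoPH N) (F : T4Family) (θ : Stage13HParams F N)
    (hP : θ.Provisos₁₃CoPH F N) (g₀ : ℕ → ℝ) (os : List (ULoop F)) :
    (shellSplitOfRecord₁₃At N K₀ ρA ρB F θ hP g₀ os).1 = shellA₁₃ θ hP K₀ g₀ os (ρA F θ hP g₀ os) := rfl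

/-- Dictionary: the split's second component is `shellB₁₃`. [bookkeeping] -/
@[simp] theorem shellSplitOfRecord₁₃At_snd (K₀ : ℕ) (ρA ρB : WidthLetter₁₃CoPH N) (F : T4Family) (θ : Stage13HParams F N)
    (hP : θ.Provisos₁₃CoPH F N) (g₀ : ℕ → ℝ) (os : List (ULoop F)) :
    (shellSplitOfRecord₁₃At N K₀ ρA ρB F θ hP g₀ os).2 = shellB₁₃ θ hP K₀ g₀ os (ρB F θ hP g₀ os) := rfl

/-- ★ Dictionary: the `shA` of the spine reading of record at this split is run A's keyed shell part of record (`rfl`). [bookkeeping] -/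
theorem crOfRecord₁₃At_shellSplit_shA (K₀ : ℕ) (jcut : ℕ → ℕ) (ρA ρB : WidthLetter₁₃CoPH N) (F : T4Family) (θ : Stage13HParams F N)
    (hP : θ.Provisos₁₃CoPH F N) (g₀ : ℕ → ℝ) (os : List (ULoop F)) :
    (crOfRecord₁₃At K₀ jcut (shellSplitOfRecord₁₃At N K₀ ρA ρB) F θ hP g₀ os).shA = shellA₁₃ θ hP K₀ g₀ os (ρA F θ hP g₀ os) := rfl

/-- ★ Dictionary: the `shB` of the spine reading of record at this split is run B's keyed shell part of record (`rfl`). [bookkeeping] -/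
theorem crOfRecord₁₃At_shellSplit_shB (K₀ : ℕ) (jcut : ℕ → ℕ) (ρA ρB : WidthLetter₁₃CoPH N) (F : T4Family) (θ : Stage13HParams F N)
    (hP : θ.Provisos₁₃CoPH F N) (g₀ : ℕ → ℝ) (os : List (ULoop F)) :
    (crOfRecord₁₃At K₀ jcut (shellSplitOfRecord₁₃At N K₀ ρA ρB) F θ hP g₀ os).shB = shellB₁₃ θ hP K₀ g₀ os (ρB F θ hP g₀ os) := rfl

end Keyed

/-! ## §4 (v1.1, APPEND-ONLY) The summed density of the truncated law and its BLOCK FIBRE LAWS (for the block disintegration of `…CoPHFibre`) -/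

section Fibre

variable (F : T4Family) (N : ℕ) [NeZero N] (ϑ : Stage9Params F N) (D : FiniteEpsData F (SU N)) (g₀ : ℕ → ℝ) (os : List (ULoop F))
  (p : B12.RunParams) (g : ℕ → ℝ) (k : ℕ)

/-- **THE SUMMED DENSITY OF THE `a`-TRUNCATED LAW** w.r.t. the product Haar measure: `V ↦ Σ_{s : a ⊂ Ω_k(s)} ofReal (χ_k^{ε_k}(Ω_k(s))(V)·slot^t_s(V))` — so that
`cubeLawOfDatum₉ … t a = (fieldMeasure …).withDensity (cubeDensityOfDatum₉ … t a)` (companion `…Fibre`). (v1.1) [bookkeeping] -/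
def cubeDensityOfDatum₉ (t : ℝ) (a : ↥(cubeIndices (F.P p.K) (cubeSide (F.P p.K).L ϑ.ν.M₂ (RkOfRecord (F.P p.K).L ϑ.ν.r (g k)) k)))
    (V : GaugeField (F.P p.K) k (SU N)) : ENNReal :=
  ∑ s : SeqOfRecord F ϑ.ν ϑ.τ9.M g p.K k,
    if a ∈ cubesOfSeq F ϑ.ν ϑ.τ9.M g p.K k s then
      ENNReal.ofReal (chiSeqOfRecord F N ϑ.ν ϑ.τ9.M g p.K k s V * dressedSlotsOfDatum₉ F N ϑ D g₀ os t p g k s V)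
    else 0

/-- ★ **THE BLOCK FIBRE LAW OF THE TRUNCATED LAW at an exterior field `x` along a finite set `b` of bonds** (the block of cube `a`, or any other): on the block
configurations `y : ↥b → SU(N)`, the product Haar measure with density `cubeDensityOfDatum₉ … t a (updateFinset x b y)` — the law the dilation ∕ hazard devices
address (a finite product of `SU(N)`'s; its exponential chart and radial Jacobian are parts 24 ∕ 27).  Integrating these fibre laws over the exterior `x` gives back
the truncated law (`MeasureTheory.lmarginal`, companion `…Fibre`). (v1.1) [bookkeeping] -/
def blockFibreLawOfDatum₉ (t : ℝ) (a : ↥(cubeIndices (F.P p.K) (cubeSide (F.P p.K).L ϑ.ν.M₂ (RkOfRecord (F.P p.K).L ϑ.ν.r (g k)) k)))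
    (b : Finset (PBond (F.P p.K) k)) (x : GaugeField (F.P p.K) k (SU N)) : Measure (↥b → SU N) :=
  letI := Classical.decEq (PBond (F.P p.K) k)
  (Measure.pi fun _ : ↥b => (HaarData.haar : Measure (SU N))).withDensity
    (fun y => cubeDensityOfDatum₉ F N ϑ D g₀ os p g k t a (Function.updateFinset x b y))

/-- **A STATISTIC READ ON THE BLOCK FIBRE through the exterior field `x`**: `y ↦ u (updateFinset x b y)` (the cube statistic in the block variables, the exterior
frozen). (v1.1) [bookkeeping] -/
def blockReading {P : Params} {j : ℕ} (u : GaugeField P j (SU N) → ℝ) (b : Finset (PBond P j)) (x : GaugeField P j (SU N)) : (↥b → SU N) → ℝ :=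
  letI := Classical.decEq (PBond P j)
  fun y => u (Function.updateFinset x b y)

/-- ★ **THE CUBE STATISTIC OF RECORD** of the top cube `a`: `sup_{p ⊂ a^∼} |U_{k,a}(V_k)(∂p) − 1| ∕ η_k²` — the (2.17) tested variable of record in threshold units
(`0` if the plaquette family is empty); the (2.17) test at the letter `δ` PASSES iff `cubeStat < δ` (companion `…Stat`, for a nonempty plaquette family). (v1.1) [bookkeeping] -/
def cubeStat {Kc k : ℕ} (ν : Stage7Numerics) (g : ℕ → ℝ)
    (a : ↥(cubeIndices (F.P Kc) (cubeSide (F.P Kc).L ν.M₂ (RkOfRecord (F.P Kc).L ν.r (g k)) k))) (V : GaugeField (F.P Kc) k (SU N)) : ℝ :=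
  let S := (Set.toFinite (plaqInside (cubeEnl (F.P Kc) (cubeSide (F.P Kc).L ν.M₂ (RkOfRecord (F.P Kc).L ν.r (g k)) k) a 1))).toFinset
  if h : S.Nonempty then
    S.sup' h (fun q => dist1 (GaugeField.plaqHol
      (B14.Eq216Concrete.ukBox (bgOfRecord (avOfRecord F N Kc) {U | PlaqSmall (ν.εreg * (F.P Kc).eta k ^ 2) U}) ν.M₁
        (cubeEnl (F.P Kc) (cubeSide (F.P Kc).L ν.M₂ (RkOfRecord (F.P Kc).L ν.r (g k)) k) a 4) k V) q)) / (F.P Kc).eta k ^ 2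
  else 0

/-- ★ **THE INPUT BLOCK OF RECORD** of the top cube `a`: the level-`k` bonds feeding the determining set `𝐁_k(a^{∼4})` of its (2.16) local background (r11's
`liftIter k (inputs 𝐁_k(a^{∼4}))`, as a `Finset`) — the block along which the truncated law is disintegrated; the cube's indicator and statistic read the field ONLY there
(companion `…Fibre` §3 ∕ `…Stat`). (v1.1) [bookkeeping] -/
def inputBlock {Kc k : ℕ} (ν : Stage7Numerics) (g : ℕ → ℝ)
    (a : ↥(cubeIndices (F.P Kc) (cubeSide (F.P Kc).L ν.M₂ (RkOfRecord (F.P Kc).L ν.r (g k)) k))) : Finset (PBond (F.P Kc) k) :=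
  (Set.toFinite (B14.Eq216Concrete.liftIter k (B14.Eq216Concrete.inputs
    (B14.Eq213DetSet.Bj ν.M₁ (cubeEnl (F.P Kc) (cubeSide (F.P Kc).L ν.M₂ (RkOfRecord (F.P Kc).L ν.r (g k)) k) a 4) k)))).toFinset

end Fibre

/-! ## §5 (v1.2, APPEND-ONLY) The per-TERM block fibre laws (one (2.18) history at a time — the consumable product shape) -/

section TermFibre

variable (F : T4Family) (N : ℕ) [NeZero N] (ϑ : Stage9Params F N) (D : FiniteEpsData F (SU N)) (g₀ : ℕ → ℝ) (os : List (ULoop F))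
  (p : B12.RunParams) (g : ℕ → ℝ) (k : ℕ)

/-- ★ **THE BLOCK FIBRE LAW OF ONE TERM** `s` at an exterior field `x` along a finite bond set `b`: product Haar on `↥b → SU(N)` with density
`y ↦ χ_k^{ε_k}(Ω_k(s))(x ⊕ y)·slot^t_s(x ⊕ y)` — ONE (2.18) history's dressed integrand with the exterior frozen (a product of the top cubes' indicators times the
dressed slot: the shape the dilation ∕ collar ENDs consume).  Summed over the terms testing a cube `a` it is `blockFibreLawOfDatum₉ … t a b x` (companion `…Term`).
(v1.2) [bookkeeping] -/
def termFibreLawOfDatum₉ (t : ℝ) (s : SeqOfRecord F ϑ.ν ϑ.τ9.M g p.K k) (b : Finset (PBond (F.P p.K) k)) (x : GaugeField (F.P p.K) k (SU N)) :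
    Measure (↥b → SU N) :=
  letI := Classical.decEq (PBond (F.P p.K) k)
  (Measure.pi fun _ : ↥b => (HaarData.haar : Measure (SU N))).withDensity
    (fun y => ENNReal.ofReal (chiSeqOfRecord F N ϑ.ν ϑ.τ9.M g p.K k s (Function.updateFinset x b y) *
      dressedSlotsOfDatum₉ F N ϑ D g₀ os t p g k s (Function.updateFinset x b y)))

end TermFibre

end Summit.QuantumFields.YangMills.Theorems.N21ShellSplitOfRecord13CoPH

end
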